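import Literature.NumberTheory.Automorphic.ArtinLFunctionsRankOnePrimitiveValues
import Literature.NumberTheory.Automorphic.ArtinLFunctionsRankOneFactorisationExplicit
import Literature.NumberTheory.GaloisRepresentations.GlobalArtinMapOfCharactersProofs
import Literature.NumberTheory.GaloisRepresentations.ChebotarevCyclicProofs
import Literature.NumberTheory.GaloisRepresentations.ChebotarevCyclotomicProofs
import HarnessLib

/-!
# The Hecke factorisation of the Dedekind zeta function of a cyclic extension, with primitive characters,
# and the conductor–discriminant formula

Topic `Literature/NumberTheory/Automorphic`; namespace `Literature.NumberTheory.Automorphic`.  Pure-proof file.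

> **Neukirch VII (10.6) with Remark, (10.4) (iv), (11.9) Corollary.**  Let `L|K` be a finite abelian (here:
> cyclic) extension with group `G`.  Then `ζ_L(s) = ∏_{χ ∈ Ĝ} L(χ̃, s)`, where `χ̃ = χ ∘ (L|K/·)` is a
> *primitive* Größencharakter `mod 𝔣(χ)` with `χ̃(𝔭) = χ(φ_𝔭)` for the primes `𝔭` unramified in `L`, and
> (conductor–discriminant formula, Hasse) `𝔡_{L|K} = ∏_χ 𝔣(χ)`, so `|d_L| = |d_K|^{[L:K]} ∏_χ 𝔑𝔣(χ)`.

For a finite cyclic Galois extension `L ⊆ K̄` of the number field `K` (an intermediate field of the algebraic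
closure), of degree `n`, and a faithful character `χ₁` of `G(L|K)`, this file produces, for every `j`, a
nonzero ideal `𝔣_j`, a **primitive** ray class character `χ_j mod 𝔣_j` with a sign type `p_j`, such that

* `χ_j(𝔭) = χ₁(φ_𝔭)^j` for every prime `𝔭` of `K` unramified in `L` (`φ_𝔭 = galFrob K L 𝔭`), and every prime
  dividing `𝔣_j` ramifies in `L`; `𝔣_0 = (1)`, `χ_0 = 1`; for `n ∤ j`, `χ_j` is non-principal;
* `ζ_L(s) = ∏_{j<n} L(χ_j, s)` for `re s > 1` (Neukirch's `rayClassLSeries`);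
* `∏_{j<n} |d_K| 𝔑(𝔣_j) = |d_L|` and `∑_{j<n} (r₁(K) - |p_j|) + n r₂(K) = r₁(L) + r₂(L)`.

Proof.  With `r : Γ_K → G(L|K)` the restriction and `ψ = χ₁ ∘ r : Γ_K → GL_1(ℂ)` (continuous: `ker r = Γ_L` is
open), `Γ_L = ker ψ`, so the explicit Artin factorisation (`completedDedekindZeta_eq_prod_of_fixingSubgroup_eq`)
gives `Λ_{ζ_L} = ∏_{j<n} Λ(ψ^j)`, `ζ_L = ∏_{j<n} L(ψ^j)`.  Each `ψ^j` has a primitive admissible datum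
`(𝔣_j, χ_j, p_j)` WITH VALUES (`exists_isAdmissibleDatum_with_values_and_matching`): `L(s, ψ^j) = L(χ_j, s)`,
`A(ψ^j) = |d_K| 𝔑𝔣_j`, `χ_j(𝔭) = det ψ^j(σ)` for Frobenii `σ ∈ Γ_K` at unramified `𝔭`; and `σ|_L = φ_𝔭`
(`isArithFrobAt_absRestrictNormalHom`, `eq_galFrob`), inertia above unramified `𝔭` dies in `G(L|K)`
(`absRestrictNormalHom_eq_one_of_isUnramifiedIn`).  Comparing the Γ-factors and constants of
`Λ_{ζ_L} = |d_L|^{s/2} Γ_ℝ^{r₁(L)} Γ_ℂ^{r₂(L)} ζ_L` and `∏ Λ(ψ^j) = (∏ A(ψ^j))^{s/2} Γ(∑n⁺, ∑n⁻; n r₂(K)) ∏ L(ψ^j)`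
(the rigidity lemmas `Rigidity.Ifac_eq_of_eqOn`, `Rigidity.rigidity_core` with `W = 1`) gives
`|d_L| = ∏_j A(ψ^j)` and the signature identity.  The non-principality of `χ_j` (`n ∤ j`) uses a prime with
Frobenius a generator (Chebotarev for cyclic extensions, `infinite_setOf_frobenius_eq_of_isCyclic`).

## References

* J. Neukirch, *Algebraic Number Theory*, Springer 1999, Ch. VII §10 Thm. (10.6) with Remark, Prop. (10.4);
  §11 (11.9) Corollary (conductor–discriminant formula); §12 p. 540. [NeukirchANT1999]
-/

noncomputable section

open scoped NumberField
open Field IsDedekindDomain NumberField NumberField.InfinitePlace Complex Filter Topology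
open Literature.NumberTheory.GaloisRepresentations Literature.NumberTheory.LFunctions
open Literature.NumberTheory.LFunctions.Rigidity

namespace Literature.NumberTheory.Automorphic

/-- Normalisation of the reciprocal Γ-factor: `I(κ; A, B, m) = I(κ; A + m, B + m, 0)` (Legendre). [folklore] -/
private theorem Ifac_shift (κ : ℝ) (A B m : ℕ) (s : ℂ) : Ifac κ A B m s = Ifac κ (A + m) (B + m) 0 s := by
  unfold Ifac; ring

variable {K : Type} [Field K] [NumberField K]
  (L : IntermediateField K (AlgebraicClosure K)) [NumberField L] [IsGalois K L] [IsCyclic (L ≃ₐ[K] L)]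

/-- **Hecke factorisation of `ζ_L` for a cyclic `L|K` with primitive characters, and the conductor–discriminant
formula** (Neukirch VII (10.6) with Remark, (10.4) (iv), (11.9) Corollary).  See the module docstring.
[cite: NeukirchANT1999, Ch. VII §10 Thm. (10.6) (Remark); Prop. (10.4) (iv); §11 (11.9) Corollary] -/
theorem exists_primitive_heckeFactorisation_of_isCyclic :
    ∃ (χ₁ : (L ≃ₐ[K] L) →* ℂˣ) (𝔣 : ℕ → Ideal (𝓞 K)) (χ : ℕ → HeightOneSpectrum (𝓞 K) → ℂ)
      (p : ℕ → Finset {w : InfinitePlace K // w.IsReal}),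
      Function.Injective χ₁ ∧
      (∀ j, 𝔣 j ≠ ⊥ ∧ IsRayClassCharacter (𝔣 j) (χ j) ∧ IsPrimitive (𝔣 j) (χ j) ∧ IsSignType (𝔣 j) (χ j) (p j)) ∧
      (∀ (j : ℕ) (v : HeightOneSpectrum (𝓞 K)), 𝔣 j ≤ v.asIdeal → ¬ Algebra.IsUnramifiedIn (𝓞 L) v.asIdeal) ∧
      (∀ (j : ℕ) (v : HeightOneSpectrum (𝓞 K)), Algebra.IsUnramifiedIn (𝓞 L) v.asIdeal →
        χ j v = ((χ₁ (galFrob K L v) : ℂˣ) : ℂ) ^ j) ∧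
      𝔣 0 = ⊤ ∧ (∀ v : HeightOneSpectrum (𝓞 K), χ 0 v = 1) ∧
      (∀ j : ℕ, ¬ Module.finrank K L ∣ j → ∃ v : HeightOneSpectrum (𝓞 K), ¬ 𝔣 j ≤ v.asIdeal ∧ χ j v ≠ 1) ∧
      (∀ s : ℂ, 1 < s.re → NumberField.dedekindZeta L s =
        ∏ j ∈ Finset.range (Module.finrank K L), rayClassLSeries (𝔣 j) (χ j) s) ∧
      ∏ j ∈ Finset.range (Module.finrank K L), ((NumberField.discr K).natAbs * Ideal.absNorm (𝔣 j)) =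
        (NumberField.discr L).natAbs ∧
      ∑ j ∈ Finset.range (Module.finrank K L), (nrRealPlaces K - (p j).card) +
          Module.finrank K L * nrComplexPlaces K = nrRealPlaces L + nrComplexPlaces L := by
  classical
  -- commutativity of the cyclic Galois group
  have hcomm : ∀ a b : L ≃ₐ[K] L, Commute a b := fun a b ↦ IsCyclic.commGroup.mul_comm a b
  -- Steps 1–3: a faithful character `χ₁`, the Artin character `ψ = χ₁ ∘ r_L` (`inflateCharacter`), `Γ_L = ker ψ`
  obtain ⟨χ₁, hχ₁⟩ := exists_monoidHom_units_complex_injective (L ≃ₐ[K] L)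
  set ψ : FramedArtinRep K 1 := inflateCharacter L χ₁ with hψdef
  have hdet : ∀ γ : absoluteGaloisGroup K, FramedRep.det ψ γ = χ₁ (absRestrictNormalHom L γ) := fun γ ↦
    Units.ext (by rw [FramedRep.det_apply, Matrix.GeneralLinearGroup.val_det_apply, Matrix.det_fin_one, hψdef,
      inflateCharacter_apply_coe])
  have hM₀ : L.fixingSubgroup = (FramedRep.det ψ).toMonoidHom.ker := by
    refine (Subgroup.ext fun γ : absoluteGaloisGroup K ↦ ?_).symm
    change FramedRep.det ψ γ = 1 ↔ absoluteGaloisGroup.toAlgEquiv K γ ∈ L.fixingSubgroup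
    rw [hdet, hχ₁.eq_iff' (map_one χ₁), absRestrictNormalHom_eq_one_iff]
  -- Step 4: the explicit Artin factorisation
  obtain ⟨Ψ, n, -, hdetΨ, h0n, hdeg, hpow, -, hfac⟩ := completedDedekindZeta_eq_prod_of_fixingSubgroup_eq ψ L hM₀
  have hpowj : ∀ (j : ℕ) (γ : absoluteGaloisGroup K), FramedRep.det (Ψ j) γ ^ n = 1 := fun j γ ↦ by
    rw [hdetΨ, ← pow_mul, mul_comm, pow_mul, hpow, one_pow]
  -- Step 5: the primitive admissible data with values
  choose 𝔣 χ p hD hsupp hvals hsig hA using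
    fun j ↦ exists_isAdmissibleDatum_with_values_and_matching (Ψ j) h0n (hpowj j)
  -- Step 6: primes unramified in `L` are unramified for every `ψ^j`, and the values there
  have hunrΨ : ∀ (j : ℕ) (v : HeightOneSpectrum (𝓞 K)), Algebra.IsUnramifiedIn (𝓞 L) v.asIdeal →
      GaloisRep.IsUnramifiedAt v (Ψ j).toArtinRep := fun j v hunr ↦
    (FramedGaloisRep.isUnramifiedAt_toGaloisRep_iff v (Ψ j)).mpr fun 𝔓 h𝔓 g hg ↦
      generalLinearGroup_fin_one_eq_of_det_eq (by
        rw [← FramedRep.det_apply, map_one, hdetΨ, hdet, absRestrictNormalHom_eq_one_of_isUnramifiedIn L hunr h𝔓 hg,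
          map_one, one_pow])
  have hval : ∀ (j : ℕ) (v : HeightOneSpectrum (𝓞 K)), Algebra.IsUnramifiedIn (𝓞 L) v.asIdeal →
      χ j v = ((χ₁ (galFrob K L v) : ℂˣ) : ℂ) ^ j := by
    intro j v hunr
    obtain ⟨𝔓, h𝔓⟩ := HeightOneSpectrum.primesAbove_nonempty v
    obtain ⟨σ, hσ⟩ := HeightOneSpectrum.exists_isArithFrobAt_of_mem_primesAbove_holds h𝔓
    haveI : 𝔓.IsPrime := h𝔓.1
    have hP := comap_ringOfIntegersToIntegralClosure_mem_primesOver_of_mem_primesAbove L h𝔓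
    have hrσ := isArithFrobAt_absRestrictNormalHom L hσ
    have heq : absRestrictNormalHom L σ = galFrob K L v := eq_galFrob hcomm hunr hP hrσ
    rw [hvals j v (hunrΨ j v hunr) 𝔓 h𝔓 σ hσ, hdetΨ, hdet, heq, Units.val_pow_eq_pow_val]
  -- Step 7: `ψ^0` is trivial: `𝔣_0 = (1)`, `χ_0 = 1`
  have hunr0 : ∀ v : HeightOneSpectrum (𝓞 K), GaloisRep.IsUnramifiedAt v (Ψ 0).toArtinRep := fun v ↦
    (FramedGaloisRep.isUnramifiedAt_toGaloisRep_iff v (Ψ 0)).mpr fun 𝔓 _ g _ ↦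
      generalLinearGroup_fin_one_eq_of_det_eq (by rw [← FramedRep.det_apply, map_one, hdetΨ, pow_zero])
  have h𝔣0 : 𝔣 0 = ⊤ := by
    by_contra h
    obtain ⟨𝔪, h𝔪, hle⟩ := Ideal.exists_le_maximal (𝔣 0) h
    have h𝔪0 : 𝔪 ≠ ⊥ := Ring.ne_bot_of_isMaximal_of_not_isField h𝔪 (RingOfIntegers.not_isField K)
    exact hsupp 0 ⟨𝔪, h𝔪.isPrime, h𝔪0⟩ hle (hunr0 _)
  have hχ0 : ∀ v : HeightOneSpectrum (𝓞 K), χ 0 v = 1 := by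
    intro v
    obtain ⟨𝔓, h𝔓⟩ := HeightOneSpectrum.primesAbove_nonempty v
    obtain ⟨σ, hσ⟩ := HeightOneSpectrum.exists_isArithFrobAt_of_mem_primesAbove_holds h𝔓
    rw [hvals 0 v (hunr0 v) 𝔓 h𝔓 σ hσ, hdetΨ, pow_zero, Units.val_one]
  -- Step 8: the degree and the non-principality of `χ_j` for `n ∤ j`
  have hcard : Nat.card (L ≃ₐ[K] L) = n := by rw [IsGalois.card_aut_eq_finrank, hdeg]
  have hnontriv : ∀ j : ℕ, ¬ n ∣ j → ∃ v : HeightOneSpectrum (𝓞 K), ¬ 𝔣 j ≤ v.asIdeal ∧ χ j v ≠ 1 := by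
    intro j hj
    obtain ⟨g, hg⟩ := IsCyclic.exists_generator (α := L ≃ₐ[K] L)
    have hinf := infinite_setOf_frobenius_eq_of_isCyclic chebotarev_cyclotomicExtension_holds g hg
    obtain ⟨v, hv⟩ := hinf.nonempty
    obtain ⟨-, hunr, hall⟩ := hv
    obtain ⟨Q, hQ, hfrob⟩ := galFrob_spec K L v
    have hgal : galFrob K L v = g := hall Q hQ _ hfrob
    refine ⟨v, fun hle ↦ hsupp j v hle (hunrΨ j v hunr), fun h1 ↦ hj ?_⟩
    rw [hval j v hunr, hgal, ← Units.val_pow_eq_pow_val, Units.val_eq_one] at h1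
    have hord : orderOf (χ₁ g) = n := by
      rw [orderOf_injective χ₁ hχ₁ g, orderOf_eq_card_of_forall_mem_zpowers hg, hcard]
    rw [← hord]
    exact orderOf_dvd_of_pow_eq_one h1
  -- Step 9: the Hecke factorisation of `ζ_L`
  have hζ : ∀ s : ℂ, 1 < s.re → NumberField.dedekindZeta L s = ∏ j ∈ Finset.range n, rayClassLSeries (𝔣 j) (χ j) s :=
    fun s hs ↦ (hfac s hs).2.trans (Finset.prod_congr rfl fun j _ ↦ (hD j).artinLFunction_eq s hs)
  -- Step 10: the conductor–discriminant formula through the rigidity of Γ-factors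
  set κZ : ℝ := ((NumberField.discr L).natAbs : ℝ) with hκZ
  set κ₁ : ℝ := ((∏ j ∈ Finset.range n, (Ψ j).toArtinRep.artinConductorNorm : ℕ) : ℝ) with hκ₁
  set A := ∑ j ∈ Finset.range n, sigPlus (Ψ j).toArtinRep with hAdef
  set B := ∑ j ∈ Finset.range n, sigMinus (Ψ j).toArtinRep with hBdef
  set m := ∑ j ∈ Finset.range n, nrComplexPlaces K * Module.finrank ℂ (Fin 1 → ℂ) with hmdef
  have hm' : m = n * nrComplexPlaces K := by rw [hmdef]; simp
  have hκZ0 : 0 < κZ := by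
    rw [hκZ]; exact_mod_cast Nat.pos_of_ne_zero (Int.natAbs_ne_zero.mpr (NumberField.discr_ne_zero L))
  have hκ₁0 : 0 < κ₁ := by
    rw [hκ₁]; exact_mod_cast Nat.pos_of_ne_zero (Finset.prod_ne_zero_iff.mpr fun j _ ↦ ArtinRep.artinConductorNorm_ne_zero' _)
  have hArtin : ∀ s : ℂ, 1 < s.re → ∏ j ∈ Finset.range n, completedArtinLFunction (Ψ j).toArtinRep s =
      (κ₁ : ℂ) ^ (s / 2) * Gfac A B m s * ∏ j ∈ Finset.range n, artinLFunction (Ψ j).toArtinRep s := by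
    intro s hs
    simp only [completedArtinLFunction, gammaFactor_eq_Gfac, Finset.prod_mul_distrib, prod_Gfac, prod_natCast_cpow]
    rw [hκ₁, hAdef, hBdef, hmdef, Complex.ofReal_natCast]
  have hZeta : ∀ s : ℂ, 1 < s.re → completedDedekindZeta L s =
      (κZ : ℂ) ^ (s / 2) * Gfac (nrRealPlaces L) 0 (nrComplexPlaces L) s * NumberField.dedekindZeta L s := by
    intro s hs
    rw [completedDedekindZeta, dedekindGammaFactor, (NumberField.isDedekindZetaContinuation_dedekindZetaCont_holds L).eqOn hs,
      Gfac, hκZ, Complex.ofReal_natCast, pow_zero, mul_one]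
    ring
  have hγ : ∀ s : ℂ, 1 < s.re →
      (κZ : ℂ) ^ (s / 2) * Gfac (nrRealPlaces L) 0 (nrComplexPlaces L) s = (κ₁ : ℂ) ^ (s / 2) * Gfac A B m s := by
    intro s hs
    have hne : NumberField.dedekindZeta L s ≠ 0 := NumberField.dedekindZeta_ne_zero_of_one_lt_re L hs
    have h := (hfac s hs).1
    rw [hZeta s hs, hArtin s hs, ← (hfac s hs).2] at h
    exact mul_right_cancel₀ hne h
  have hI : ∀ s : ℂ, Ifac κZ (nrRealPlaces L + nrComplexPlaces L) (0 + nrComplexPlaces L) 0 s =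
      Ifac κ₁ (A + m) (B + m) 0 s := fun s ↦ by
    rw [← Ifac_shift, ← Ifac_shift]; exact Ifac_eq_of_eqOn hκZ0 hκ₁0 hγ s
  -- degrees: `r₁(L) + 2 r₂(L) = [L:ℚ] = n [K:ℚ] = A + B + 2m`
  have hAB : (nrRealPlaces L + nrComplexPlaces L) + (0 + nrComplexPlaces L) = (A + m) + (B + m) := by
    have h1 : nrRealPlaces L + 2 * nrComplexPlaces L = Module.finrank ℚ L := card_add_two_mul_card_eq_rank L
    have h2 : nrRealPlaces K + 2 * nrComplexPlaces K = Module.finrank ℚ K := card_add_two_mul_card_eq_rank K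
    have h3 : Module.finrank ℚ L = Module.finrank ℚ K * n := by rw [← hdeg, Module.finrank_mul_finrank]
    have h4 : A + B = n * nrRealPlaces K := by
      rw [hAdef, hBdef, ← Finset.sum_add_distrib, Finset.sum_congr rfl (fun j _ ↦ sigPlus_add_sigMinus (Ψ j).toArtinRep),
        Finset.sum_const, Finset.card_range, smul_eq_mul, Module.finrank_fin_fun, mul_one]
    have h5 : (A + m) + (B + m) = n * (nrRealPlaces K + 2 * nrComplexPlaces K) := by rw [hm']; linear_combination h4
    have h6 : nrRealPlaces L + 2 * nrComplexPlaces L = n * Module.finrank ℚ K := by rw [h1, h3, mul_comm]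
    rw [h5, h2]
    omega
  obtain ⟨hsigma, hκ⟩ := rigidity_core (W := 1) hκZ0 hκ₁0 one_ne_zero hAB (fun s ↦ by rw [hI (1 - s), hI s]; ring)
  -- Step 11: assembling the statement
  have hdisc : ∏ j ∈ Finset.range n, ((NumberField.discr K).natAbs * Ideal.absNorm (𝔣 j)) = (NumberField.discr L).natAbs := by
    have h1 : ((NumberField.discr L).natAbs : ℝ) = ((∏ j ∈ Finset.range n, (Ψ j).toArtinRep.artinConductorNorm : ℕ) : ℝ) := hκ
    rw [← Nat.cast_inj (R := ℝ), ← h1.symm]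
    exact_mod_cast (Finset.prod_congr rfl fun j _ ↦ (hA j).symm)
  have hsign : ∑ j ∈ Finset.range n, (nrRealPlaces K - (p j).card) + n * nrComplexPlaces K =
      nrRealPlaces L + nrComplexPlaces L := by
    rw [hsigma, hAdef, hm', Finset.sum_congr rfl (fun j _ ↦ hsig j)]
  refine ⟨χ₁, 𝔣, χ, p, hχ₁, fun j ↦ ⟨(hD j).ne_bot, (hD j).isRayClassCharacter, (hD j).isPrimitive, (hD j).isSignType⟩,
    fun j v hle hunr ↦ hsupp j v hle (hunrΨ j v hunr), hval, h𝔣0, hχ0, ?_, ?_, ?_, ?_⟩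
  · rw [hdeg]; exact hnontriv
  · rw [hdeg]; exact hζ
  · rw [hdeg]; exact hdisc
  · rw [hdeg]; exact hsign

end Literature.NumberTheory.Automorphic
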